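import Literature.Computability.Cryptography.RegevCVPOracleWeighted
import Literature.Algebra.EuclideanLattices.RegevQuantumPartLongTail
import HarnessLib

/-!
# Regev 2009, Lemma 3.14 with the `CVP` procedure: the inadmissible queries have negligible weight

Topic `Computability/Cryptography` (family `pqc`), grouping namespace `Regev2009.CVPOracle`; sequel of
`RegevCVPOracleWeighted.lean` (`dataLaw`: the law of the query data `c(x)` under the box Gaussian
weights `(ρ(x)/Z)²`; `sum_mul_errFn_le_weightedFail_add`: the Gaussian average of the tidy-block error
of the `CVP` family is at most `weightedFail + ` the mass `dataLaw{¬Admissible_d}` of the INADMISSIBLE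
data) and of `Algebra/EuclideanLattices/RegevQuantumPartLongTail.lean` (`QPart.sum_boxWeight_long_le`:
the points with long lattice part, `‖x − y(x)‖ ≥ √n`, have Gaussian weight at most `(2C)²`). In Regev's
sampler (J. ACM 56 (2009), art. 34, Lemma 3.14 as used in the proof of Lemma 3.3, with the `CVP`
procedure of Lemma 3.4 in place of the `CVP_{L*, αq/(√2 r)}` oracle) the query of a point is admissible
— its point lies within the radius of `L*` — as soon as the point's lattice part is SHORT (in the
rescaled units of this series the admissibility radius is `√n`); so the inadmissible mass is a Gaussian
tail:

* `dataLaw_toOuterMeasure_toReal_le` — the `dataLaw`-mass of an event is at most the weight of any set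
  of points containing its preimage;
* **`dataLaw_inadmissible_le_of_short`** — if every box point with short lattice part has admissible
  data, `(dataLaw{¬Admissible I d}).toReal ≤ (2C)²` under the smallness hypothesis of
  `RegevQuantumPartStates` (`C = e^{2πBY} 2⁻ⁿ/κ`, exponentially small in Regev's parameters).

Everything is proved; no definition, no named fact is introduced.

## References

* O. Regev, *On lattices, learning with errors, random linear codes, and cryptography*, J. ACM 56
  (2009), art. 34; author's version arXiv:2401.03703: Lemma 3.3 (proof, p. 15), Claim 3.13, Lemma 3.14
  (proof, p. 20) [Regev2009].
* W. Banaszczyk, *New bounds in some transference theorems in the geometry of numbers*, Math. Ann. 296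
  (1993) 625–635, Lemma 1.5 [Banaszczyk1993].
-/

noncomputable section

namespace Literature.Computability.Cryptography

open _root_.Computability Literature.Computability.Complexity Literature.Computability.QuantumComplexity
  Literature.Algebra.EuclideanLattices Literature.Algebra.EuclideanLattices.Regev2009
  Literature.Algebra.EuclideanLattices.Regev2009.QPart Finset Module

open scoped ENNReal Real

namespace Regev2009

namespace CVPOracle

variable {ι : Type*} {n : ℕ}

/-- **The `dataLaw`-mass of an event is at most the weight of any set of points containing its preimage.**
[folklore] -/
theorem dataLaw_toOuterMeasure_toReal_le (T : Finset ι) (p : ι → ℝ) (hp0 : ∀ x ∈ T, 0 ≤ p x) (hp1 : ∑ x ∈ T, p x = 1)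
    (cOf : ι → QData n) (E : Set (QData n)) (P : ι → Prop) [DecidablePred P] (hPE : ∀ x ∈ T, cOf x ∈ E → P x) :
    ((dataLaw T p hp0 hp1 cOf).toOuterMeasure E).toReal ≤ ∑ x ∈ T.filter P, p x := by
  classical
  rw [dataLaw_toOuterMeasure_apply, ENNReal.toReal_ofReal (sum_nonneg fun x hx => hp0 x (mem_filter.1 hx).1)]
  refine sum_le_sum_of_subset_of_nonneg (fun x hx => ?_) (fun x hx _ => hp0 x (mem_filter.1 hx).1)
  rw [mem_filter] at hx ⊢
  exact ⟨hx.1, hPE x hx.1 hx.2⟩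

/-- **The inadmissible queries have weight at most `(2C)²`** when every box point with short lattice part
(`‖x − y(x)‖ < √n`) has admissible data: the inadmissible data come from long points, a Gaussian tail.
[cite: Regev2009, Lemma 3.3 (proof), Lemma 3.14 (proof), Claim 3.13] [cite: Banaszczyk1993, Lemma 1.5] -/
theorem dataLaw_inadmissible_le_of_short {V : Type*} [NormedAddCommGroup V] [InnerProductSpace ℝ V]
    [FiniteDimensional ℝ V] [MeasurableSpace V] [BorelSpace V] [DecidableEq V]
    {Λ : Submodule ℤ V} [DiscreteTopology Λ] [IsZLattice ℝ Λ] {m κ W : ℕ} {e : Module.Basis (Fin m) ℤ Λ}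
    [NeZero (2 ^ κ : ℕ)] {Box : Finset V} {yOf : V → V} {sOf : V → Fin m → ZMod (2 ^ κ)} {Good : V → Prop}
    [DecidablePred Good] {S : Fin m → (Fin κ ↪ Fin W)} {base : V → QReg W} {enc : ZMod (2 ^ κ) → Fin κ → Bool}
    {lab₀ : V → QReg W} {κc : QReg W → QReg W} {B Y C : ℝ}
    (hH : FibreHyps Λ e (2 ^ κ) Box yOf sOf Good) (hR : RegHyps S base enc Box yOf sOf Good lab₀ κc) (hne : Box.Nonempty)
    (hsvΛ : ∀ z ∈ scaledLattice Λ (2 ^ κ), ‖z‖ < 2 * Real.sqrt (finrank ℝ V) → z = 0)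
    (hBox : ∀ x ∈ Box, BoxCoversShort Λ Box (yOf x)) (hY : ∀ x ∈ Box, ‖yOf x‖ ≤ Y)
    (hB : ∀ x ∈ Box, ∀ x' ∈ Box, ‖x - yOf x'‖ ≤ B)
    (hδ : π * (2 * Real.sqrt (finrank ℝ V) * Y + Y ^ 2) < 1)
    (hC : Real.exp (2 * π * B * Y) * (2⁻¹ : ℝ) ^ finrank ℝ V ≤
      C * ((1 - π * (2 * Real.sqrt (finrank ℝ V) * Y + Y ^ 2)) * (1 - banaConst ^ finrank ℝ V) * (1 - (4⁻¹ : ℝ) ^ finrank ℝ V)))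
    (hC2 : C ≤ 1 / 2) (hC0 : 0 ≤ C)
    (I : LatticeInstance) (d : ℝ) (cOf : V → QData I.n)
    (hAdm : ∀ x ∈ Box, ‖x - yOf x‖ < Real.sqrt (finrank ℝ V) → Admissible I d (cOf x)) :
    ((dataLaw Box (fun x => (gaussianFunction 1 x / zBox Box) ^ 2) (fun _ _ => sq_nonneg _) (sum_boxWeight_eq_one hne) cOf).toOuterMeasure
        {c | ¬ Admissible I d c}).toReal ≤ (2 * C) ^ 2 := by
  classical
  refine (dataLaw_toOuterMeasure_toReal_le Box _ (fun _ _ => sq_nonneg _) (sum_boxWeight_eq_one hne) cOf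
    {c | ¬ Admissible I d c} (fun x => Real.sqrt (finrank ℝ V) ≤ ‖x - yOf x‖) fun x hx hnot => ?_).trans
    (sum_boxWeight_long_le hH hR hne hsvΛ hBox hY hB hδ hC hC2 hC0)
  exact le_of_not_gt fun hlt => hnot (hAdm x hx hlt)

end CVPOracle

end Regev2009

end Literature.Computability.Cryptography

end
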